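import Literature.NumberTheory.EllipticCurves.SupersingularDensitySerreProofs
import Literature.NumberTheory.Sieve.ParityWave0Proofs
import Mathlib.NumberTheory.LegendreSymbol.JacobiSymbol
import HarnessLib

/-!
# Natural density of sets of primes: the toolkit behind Deuring's density `1/2`

Sibling *proofs* file (D-0014 append protocol: nothing is asserted, every declaration is a
theorem) of `Literature.NumberTheory.EllipticCurves.SupersingularDensity`, which defines the
relative counting function `WeierstrassCurve.primeCountingRatio S x = #{p ≤ x : p ∈ S}/π(x)` and
the natural (prime) density `WeierstrassCurve.HasPrimeDensity S δ` (`… → δ` along `x : ℕ`) and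
vendors the named fact `WeierstrassCurve.deuring_supersingular_density_half` (Deuring 1941: the
supersingular primes of a CM elliptic curve over `ℚ` — the good primes inert in the CM field —
have density `1/2`).

This file proves the **analytic half** of that statement, in the form the algebraic half
(Deuring's criterion `p supersingular ⇔ (D/p) = -1` for the CM discriminant `D < 0`, up to
finitely many `p`) consumes:

* `WeierstrassCurve.hasPrimeDensity_setOf_jacobiSym_eq_neg_one` — for every integer `D < 0` the
  set of primes `p` with Jacobi (= Legendre) symbol `(D/p) = -1` has natural density `1/2`.

The proof is the classical one: `(D/p)` depends only on `p mod 4|D|` (Mathlib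
`jacobiSym.mod_right`, i.e. quadratic reciprocity with the supplements), the residues
`r mod 4|D|` prime to `4D` with `(D/r) = -1` are exactly half of all reduced residues (the
involution `r ↦ 4|D| - r` changes the sign of the symbol, because `(D/4|D|-1) = χ₄(-1) = -1` for
`D < 0`), and each reduced residue class has prime density `1/φ(4|D|)` by the prime number
theorem for arithmetic progressions `π(x; q, a) ∼ π(x)/φ(q)` — a THEOREM of the tree,
`Literature.NumberTheory.Sieve.primeCountingMod_isEquivalent_holds` (`ParityWave0Proofs`,
de la Vallée Poussin 1896 via Wiener–Ikehara, Montgomery–Vaughan Cor. 11.20).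

## Contents (all proved)

* §1 `HasPrimeDensity.congr_of_eventually`: sets of naturals agreeing at all sufficiently large
  primes have the same density (from the density calculus of `SupersingularDensitySerreProofs`:
  `HasPrimeDensity.congr`, `HasPrimeDensity.of_finite_diff`).
* §2 `hasPrimeDensity_setOf_modEq`: `{p ≡ a (mod q)}` has density `1/φ(q)` for `(a, q) = 1`.
* §3 `HasPrimeDensity.union`, `hasPrimeDensity_biUnion`: finite additivity over pairwise
  disjoint sets.
* §4 `jacobiSym_four_mul_natAbs_sub_one`, `jacobiSym_sub_eq_neg`,
  `two_mul_card_filter_jacobiSym_eq_neg_one`: for `D < 0`, `(D/4|D|-1) = -1`,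
  `(D/4|D|-r) = -(D/r)`, and the residues with symbol `-1` are half of the `φ(4|D|)` reduced ones.
* §5 `hasPrimeDensity_setOf_jacobiSym_eq_neg_one`.

## References

* M. Deuring, *Die Typen der Multiplikatorenringe elliptischer Funktionenkörper*, Abh. Math.
  Sem. Univ. Hamburg 14 (1941), 197–272 (the density-`1/2` statement this toolkit serves).
* J.-P. Serre, *Quelques applications du théorème de densité de Chebotarev*, Publ. Math. IHÉS
  54 (1981), §1 (densities of sets of primes), §7.2 Remarque 3 (forms of CM type: `a_p = 0` on a
  set of primes of positive density). Held: `paper:doi-10-1007-bf02698692`. [Serre1981]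
* H. L. Montgomery, R. C. Vaughan, *Multiplicative Number Theory I*, CUP 2007, Cor. 11.20
  (`π(x; q, a) ∼ x/(φ(q) log x)`), §9.3 (the Jacobi/Kronecker symbol as a character modulo
  `4|D|`). [MontgomeryVaughan2007]

## Design

Pure theorems next to the statement file, in its namespace `WeierstrassCurve` (where
`primeCountingRatio` and `HasPrimeDensity` live), on top of the density calculus of the sibling
`SupersingularDensitySerreProofs` (`primeCountingRatio_eq`, `HasPrimeDensity.congr`,
`HasPrimeDensity.of_finite_diff`, `HasPrimeDensity.of_finite`); `open scoped Classical` for the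
`Finset.filter` forms of the counting functions. The prime number theorem for progressions enters
only through `Literature.NumberTheory.Sieve.primeCountingMod_isEquivalent_holds`.
-/

noncomputable section

open scoped Classical NumberTheorySymbols Nat.Prime

open Filter Topology Finset Asymptotics

namespace WeierstrassCurve

/-! ### §1 Finite modifications do not change the density -/

/-- `π(x) ≠ 0` for `x ≥ 2`. [folklore] -/
theorem primeCounting_ne_zero_of_two_le {x : ℕ} (hx : 2 ≤ x) : π x ≠ 0 := by
  rw [Ne, Nat.primeCounting_eq_zero_iff]
  omega

/-- **Sets agreeing at all large primes have the same natural density**: if `p ∈ S ↔ p ∈ T`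
for every prime `p ≥ N`, then `HasPrimeDensity S δ → HasPrimeDensity T δ` (the density only
sees primes, `HasPrimeDensity.congr`, and finitely many exceptions are invisible,
`HasPrimeDensity.of_finite_diff`, both from `SupersingularDensitySerreProofs`). Serre 1981, §1.
[folklore] -/
theorem HasPrimeDensity.congr_of_eventually {S T : Set ℕ} {δ : ℝ} (hS : HasPrimeDensity S δ)
    (N : ℕ) (h : ∀ p, N ≤ p → p.Prime → (p ∈ S ↔ p ∈ T)) : HasPrimeDensity T δ := by
  -- pass to the sets of primes of `S` and of `T`, which differ by finitely many elements
  have hS' : HasPrimeDensity {p | p.Prime ∧ p ∈ S} δ :=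
    hS.congr fun p hp => by simp [hp]
  have hT' : HasPrimeDensity {p | p.Prime ∧ p ∈ T} δ := by
    refine hS'.of_finite_diff ((Set.finite_lt_nat N).subset ?_) ((Set.finite_lt_nat N).subset ?_)
    · rintro p ⟨⟨hp, hpT⟩, hpS⟩
      simp only [Set.mem_setOf_eq, not_and] at hpS ⊢
      by_contra hN
      exact hpS hp ((h p (not_lt.1 hN) hp).2 hpT)
    · rintro p ⟨⟨hp, hpS⟩, hpT⟩
      simp only [Set.mem_setOf_eq, not_and] at hpT ⊢
      by_contra hN
      exact hpT hp ((h p (not_lt.1 hN) hp).1 hpS)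
  exact hT'.congr fun p hp => by simp [hp]

/-! ### §2 Reduced residue classes: `π(x; q, a) ∼ π(x)/φ(q)` -/

/-- The tree's `primeCountingMod q a x = #{p ≤ x : p prime, p ≡ a (mod q)}` is the numerator of
`primeCountingRatio {p | p ≡ a (mod q)} x`. [folklore] -/
theorem primeCountingMod_eq_card_filter_primesLE (q a x : ℕ) {S : Set ℕ}
    (hS : S = {p : ℕ | p ≡ a [MOD q]}) :
    Literature.NumberTheory.Sieve.ParityWave0.primeCountingMod q a x =
      #{p ∈ Nat.primesLE x | p ∈ S} := by
  subst hS
  rw [Literature.NumberTheory.Sieve.ParityWave0.primeCountingMod, Nat.primesLE_eq_filter_range,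
    filter_filter]
  congr 1
  ext p
  simp only [mem_filter, Set.mem_setOf_eq]

/-- **The primes in a reduced residue class have natural density `1/φ(q)`**: for `q ≥ 1` and
`(a, q) = 1`, `#{p ≤ x : p ≡ a (mod q)}/π(x) → 1/φ(q)` — the prime number theorem for
arithmetic progressions in the form `π(x; q, a) ∼ π(x)/φ(q)` (de la Vallée Poussin 1896;
Montgomery–Vaughan Cor. 11.20), a theorem of the tree
(`Literature.NumberTheory.Sieve.primeCountingMod_isEquivalent_holds`).
[cite: MontgomeryVaughan2007, Cor. 11.20 (11.33)] -/
theorem hasPrimeDensity_setOf_modEq {q a : ℕ} (hq : q ≠ 0) (ha : a.Coprime q) :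
    HasPrimeDensity {p : ℕ | p ≡ a [MOD q]} ((q.totient : ℝ)⁻¹) := by
  have hφ : (q.totient : ℝ) ≠ 0 := by
    exact_mod_cast (Nat.totient_pos.mpr (Nat.pos_of_ne_zero hq)).ne'
  have hE := Literature.NumberTheory.Sieve.primeCountingMod_isEquivalent_holds hq ha
  have hz : ∀ᶠ x : ℕ in atTop, (π x : ℝ) / q.totient ≠ 0 := by
    filter_upwards [eventually_ge_atTop 2] with x hx
    exact div_ne_zero (by exact_mod_cast primeCounting_ne_zero_of_two_le hx) hφ
  have h1 := (isEquivalent_iff_tendsto_one hz).mp hE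
  have h2 : Tendsto (fun x : ℕ =>
      (Literature.NumberTheory.Sieve.ParityWave0.primeCountingMod q a x : ℝ) /
        ((π x : ℝ) / q.totient) * (q.totient : ℝ)⁻¹) atTop (𝓝 (1 * (q.totient : ℝ)⁻¹)) :=
    h1.mul tendsto_const_nhds
  rw [one_mul] at h2
  refine h2.congr' ?_
  filter_upwards [eventually_ge_atTop 2] with x hx
  have hπ : (π x : ℝ) ≠ 0 := by exact_mod_cast primeCounting_ne_zero_of_two_le hx
  rw [primeCountingRatio_eq, ← primeCountingMod_eq_card_filter_primesLE q a x rfl]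
  field_simp

/-! ### §3 Finite additivity -/

/-- The counting function of a disjoint union is the sum of the counting functions. [folklore] -/
theorem card_filter_primesLE_union {S T U : Set ℕ} (hU : U = S ∪ T) (hST : Disjoint S T) (x : ℕ) :
    #{p ∈ Nat.primesLE x | p ∈ U} =
      #{p ∈ Nat.primesLE x | p ∈ S} + #{p ∈ Nat.primesLE x | p ∈ T} := by
  have h : {p ∈ Nat.primesLE x | p ∈ U} =
      {p ∈ Nat.primesLE x | p ∈ S} ∪ {p ∈ Nat.primesLE x | p ∈ T} := by
    ext p
    simp only [mem_filter, hU, Set.mem_union, mem_union]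
    tauto
  rw [h, card_union_of_disjoint]
  rw [disjoint_filter]
  intro p _ hpS hpT
  exact Set.disjoint_left.1 hST hpS hpT

/-- **Additivity of natural density over a disjoint union.** [folklore] -/
theorem HasPrimeDensity.union {S T : Set ℕ} {δ ε : ℝ} (hS : HasPrimeDensity S δ)
    (hT : HasPrimeDensity T ε) (hST : Disjoint S T) : HasPrimeDensity (S ∪ T) (δ + ε) := by
  refine (hS.add hT).congr fun x => ?_
  rw [primeCountingRatio_eq, primeCountingRatio_eq,
    primeCountingRatio_eq, card_filter_primesLE_union (U := S ∪ T) rfl hST, Nat.cast_add,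
    add_div]

/-- **Additivity of natural density over a finite pairwise disjoint union.** [folklore] -/
theorem hasPrimeDensity_biUnion {ι : Type*} (s : Finset ι) {S : ι → Set ℕ} {δ : ι → ℝ}
    (h : ∀ i ∈ s, HasPrimeDensity (S i) (δ i)) (hd : (s : Set ι).PairwiseDisjoint S) :
    HasPrimeDensity (⋃ i ∈ s, S i) (∑ i ∈ s, δ i) := by
  induction s using Finset.induction_on with
  | empty => simpa using HasPrimeDensity.of_finite Set.finite_empty
  | @insert a s ha ih =>
    rw [Finset.set_biUnion_insert, Finset.sum_insert ha]
    have hd' : (s : Set ι).PairwiseDisjoint S :=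
      hd.subset (Finset.coe_subset.2 (Finset.subset_insert a s))
    refine (h a (mem_insert_self a s)).union (ih (fun i hi => h i (mem_insert_of_mem hi)) hd') ?_
    rw [Set.disjoint_iUnion₂_right]
    intro i hi
    exact hd (mem_insert_self a s) (mem_insert_of_mem hi) (fun hai => ha (hai ▸ hi))

/-! ### §4 The Jacobi symbol `(D/·)` modulo `4|D|` for `D < 0` -/

section Jacobi

variable {D : ℤ}

/-- For `D < 0`, `4|D| - 1` is odd. [folklore] -/
theorem odd_four_mul_natAbs_sub_one (hD : D < 0) : Odd (4 * D.natAbs - 1) := by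
  have hm : 0 < D.natAbs := Int.natAbs_pos.mpr hD.ne
  refine ⟨2 * D.natAbs - 1, ?_⟩
  omega

/-- **`(D / 4|D|-1) = -1` for `D < 0`**: with `m = |D|`, `(D/4m-1) = χ₄(4m-1)·(m/4m-1)` and
`(m/4m-1) = (4m/4m-1) = (1/4m-1) = 1` (`4` is a square, `4m ≡ 1`), `χ₄(4m-1) = -1`.
Montgomery–Vaughan §9.3 (the Kronecker symbol is an odd character for `D < 0`).
[cite: MontgomeryVaughan2007, §9.3] -/
theorem jacobiSym_four_mul_natAbs_sub_one (hD : D < 0) : J(D | 4 * D.natAbs - 1) = -1 := by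
  have hm : 0 < D.natAbs := Int.natAbs_pos.mpr hD.ne
  have hodd := odd_four_mul_natAbs_sub_one hD
  have hDm : D = -(D.natAbs : ℤ) := by
    rw [Int.natCast_natAbs, abs_of_neg hD, neg_neg]
  have hb : ((4 * D.natAbs - 1 : ℕ) : ℤ) = 4 * (D.natAbs : ℤ) - 1 := by
    have h1 : 1 ≤ 4 * D.natAbs := by omega
    push_cast [h1]
    ring
  -- `(m / 4m-1) = 1`
  have h1 : J((D.natAbs : ℤ) | 4 * D.natAbs - 1) = 1 := by
    have h4m : J(4 * (D.natAbs : ℤ) | 4 * D.natAbs - 1) = J((D.natAbs : ℤ) | 4 * D.natAbs - 1) := by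
      rw [jacobiSym.mul_left, jacobiSym.at_four hodd, one_mul]
    have h4m' : J(4 * (D.natAbs : ℤ) | 4 * D.natAbs - 1) = J(1 | 4 * D.natAbs - 1) := by
      rw [jacobiSym.mod_left (4 * (D.natAbs : ℤ)), jacobiSym.mod_left 1, hb]
      congr 1
      rw [Int.emod_eq_emod_iff_emod_sub_eq_zero, Int.emod_self]
    rw [← h4m, h4m', jacobiSym.one_left]
  have hD' : J(D | 4 * D.natAbs - 1) = J(-(D.natAbs : ℤ) | 4 * D.natAbs - 1) := by rw [← hDm]
  rw [hD', jacobiSym.neg _ hodd, h1, mul_one]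
  exact ZMod.χ₄_nat_three_mod_four (by omega)

/-- **`(D / 4|D|-r) = -(D / r)`** for `D < 0` and odd `r < 4|D|`: the symbol `(D/b)` depends
only on `b mod 4|D|` (Mathlib `jacobiSym.mod_right`, quadratic reciprocity) and is
multiplicative in `b`, while `(4|D|-1)·r ≡ 4|D| - r` and `(D/4|D|-1) = -1`.
[cite: MontgomeryVaughan2007, §9.3] -/
theorem jacobiSym_sub_eq_neg (hD : D < 0) {r : ℕ} (hr : Odd r) (hrq : r < 4 * D.natAbs) :
    J(D | 4 * D.natAbs - r) = -J(D | r) := by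
  have hm : 0 < D.natAbs := Int.natAbs_pos.mpr hD.ne
  have hr0 : r ≠ 0 := by rintro rfl; exact Nat.not_odd_zero hr
  have hodd := odd_four_mul_natAbs_sub_one hD
  have hb0 : 4 * D.natAbs - 1 ≠ 0 := by omega
  have hodd' : Odd (4 * D.natAbs - r) :=
    Nat.Even.sub_odd hrq.le (Nat.even_mul.2 (Or.inl (by decide))) hr
  -- `(4m-1) r ≡ 4m - r (mod 4m)`
  have hmod : (4 * D.natAbs - 1) * r ≡ 4 * D.natAbs - r [MOD 4 * D.natAbs] := by
    rw [Nat.modEq_iff_dvd]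
    have h1 : 1 ≤ 4 * D.natAbs := by omega
    push_cast [h1, hrq.le]
    exact ⟨1 - (r : ℤ), by ring⟩
  have hmod' : (4 * D.natAbs - 1) * r % (4 * D.natAbs) = (4 * D.natAbs - r) % (4 * D.natAbs) :=
    hmod
  have hprod : J(D | (4 * D.natAbs - 1) * r) = J(D | 4 * D.natAbs - r) := by
    rw [jacobiSym.mod_right D (hodd.mul hr), jacobiSym.mod_right D hodd', hmod']
  rw [← hprod, jacobiSym.mul_right' D hb0 hr0, jacobiSym_four_mul_natAbs_sub_one hD, neg_one_mul]

/-- A residue prime to `4|D|` is odd and prime to `D`, so its symbol is `±1`. [folklore] -/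
theorem jacobiSym_eq_one_or_eq_neg_one_of_coprime {r : ℕ} (hr : r.Coprime (4 * D.natAbs)) : Odd r ∧ (J(D | r) = 1 ∨ J(D | r) = -1) := by
  refine ⟨?_, jacobiSym.eq_one_or_neg_one ?_⟩
  · have h2 : r.Coprime 2 :=
      Nat.Coprime.coprime_dvd_right ⟨2 * D.natAbs, by ring⟩ hr
    exact Nat.coprime_two_right.mp h2
  · rw [Int.gcd_eq_natAbs, Int.natAbs_natCast]
    exact (Nat.Coprime.coprime_dvd_right (dvd_mul_left D.natAbs 4) hr).symm

/-- **Exactly half of the reduced residues modulo `4|D|` have `(D/r) = -1`** (`D < 0`): the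
involution `r ↦ 4|D| - r` of the reduced residues exchanges the residues with symbol `-1` and
those with symbol `+1` (`jacobiSym_sub_eq_neg`). Montgomery–Vaughan §9.3 (a nontrivial real
character takes the value `-1` on half of the group). [cite: MontgomeryVaughan2007, §9.3] -/
theorem two_mul_card_filter_jacobiSym_eq_neg_one (hD : D < 0) :
    2 * #{r ∈ range (4 * D.natAbs) | r.Coprime (4 * D.natAbs) ∧ J(D | r) = -1} =
      Nat.totient (4 * D.natAbs) := by
  have hm : 0 < D.natAbs := Int.natAbs_pos.mpr hD.ne
  -- `U = A ⊔ B`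
  have hUAB : ({r ∈ range (4 * D.natAbs) | r.Coprime (4 * D.natAbs)} : Finset ℕ) =
      {r ∈ range (4 * D.natAbs) | r.Coprime (4 * D.natAbs) ∧ J(D | r) = -1} ∪
        {r ∈ range (4 * D.natAbs) | r.Coprime (4 * D.natAbs) ∧ J(D | r) = 1} := by
    ext r
    simp only [mem_filter, mem_union, mem_range]
    constructor
    · rintro ⟨hr, hc⟩
      rcases (jacobiSym_eq_one_or_eq_neg_one_of_coprime hc).2 with h | h
      · exact Or.inr ⟨hr, hc, h⟩
      · exact Or.inl ⟨hr, hc, h⟩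
    · rintro (⟨hr, hc, -⟩ | ⟨hr, hc, -⟩) <;> exact ⟨hr, hc⟩
  have hAB : Disjoint
      ({r ∈ range (4 * D.natAbs) | r.Coprime (4 * D.natAbs) ∧ J(D | r) = -1} : Finset ℕ)
      {r ∈ range (4 * D.natAbs) | r.Coprime (4 * D.natAbs) ∧ J(D | r) = 1} := by
    rw [disjoint_filter]
    rintro r - ⟨-, h1⟩ ⟨-, h2⟩
    rw [h1] at h2
    norm_num at h2
  -- the involution `r ↦ 4|D| - r` maps `A` onto `B`
  have hmem : ∀ {r : ℕ}, r ∈ range (4 * D.natAbs) → r.Coprime (4 * D.natAbs) →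
      4 * D.natAbs - r ∈ range (4 * D.natAbs) ∧ (4 * D.natAbs - r).Coprime (4 * D.natAbs) ∧
        J(D | 4 * D.natAbs - r) = -J(D | r) := by
    intro r hr hc
    rw [mem_range] at hr ⊢
    have hr0 : r ≠ 0 := by
      rintro rfl
      rw [Nat.coprime_zero_left] at hc
      omega
    refine ⟨by omega, (Nat.coprime_self_sub_left hr.le).mpr hc, ?_⟩
    exact jacobiSym_sub_eq_neg hD (jacobiSym_eq_one_or_eq_neg_one_of_coprime hc).1 hr
  have hcard : #{r ∈ range (4 * D.natAbs) | r.Coprime (4 * D.natAbs) ∧ J(D | r) = -1} =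
      #{r ∈ range (4 * D.natAbs) | r.Coprime (4 * D.natAbs) ∧ J(D | r) = 1} := by
    refine card_bij (fun r _ => 4 * D.natAbs - r) (fun r hr => ?_) (fun r₁ hr₁ r₂ hr₂ h => ?_)
      (fun r hr => ?_)
    · simp only [mem_filter] at hr
      obtain ⟨h1, h2, h3⟩ := hmem hr.1 hr.2.1
      simp only [mem_filter]
      exact ⟨h1, h2, by rw [h3, hr.2.2, neg_neg]⟩
    · simp only [mem_filter, mem_range] at hr₁ hr₂
      change 4 * D.natAbs - r₁ = 4 * D.natAbs - r₂ at h
      omega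
    · simp only [mem_filter] at hr
      obtain ⟨h1, h2, h3⟩ := hmem hr.1 hr.2.1
      refine ⟨4 * D.natAbs - r, ?_, ?_⟩
      · simp only [mem_filter]
        exact ⟨h1, h2, by rw [h3, hr.2.2]⟩
      · have := mem_range.1 hr.1
        show 4 * D.natAbs - (4 * D.natAbs - r) = r
        omega
  have htot : Nat.totient (4 * D.natAbs) =
      #({r ∈ range (4 * D.natAbs) | r.Coprime (4 * D.natAbs)} : Finset ℕ) := by
    rw [Nat.totient_eq_card_coprime]
    congr 1
    exact filter_congr fun r _ => Nat.coprime_comm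
  rw [htot, hUAB, card_union_of_disjoint hAB, ← hcard, two_mul]

end Jacobi

/-! ### §5 The primes with `(D/p) = -1` have density `1/2` -/

/-- **The primes `p` with `(D/p) = -1` have natural density `1/2`** for every integer `D < 0`
(here `(D/p)` is the Jacobi symbol `J(D | p)`, the Legendre symbol at odd primes `p`; the
condition forces `p ∤ 2D`). These are the primes inert in `ℚ(√D)`; by quadratic reciprocity
(`jacobiSym.mod_right`) they are the primes in the `φ(4|D|)/2` reduced residue classes
`r mod 4|D|` with `(D/r) = -1` (`two_mul_card_filter_jacobiSym_eq_neg_one`), each of density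
`1/φ(4|D|)` by the prime number theorem for arithmetic progressions
(`hasPrimeDensity_setOf_modEq`). This is the analytic input of Deuring's theorem that the
supersingular primes of a CM elliptic curve over `ℚ` have density `1/2`.
[cite: MontgomeryVaughan2007, Cor. 11.20 and §9.3] -/
theorem hasPrimeDensity_setOf_jacobiSym_eq_neg_one {D : ℤ} (hD : D < 0) :
    HasPrimeDensity {p : ℕ | J(D | p) = -1} (1 / 2) := by
  have hm : 0 < D.natAbs := Int.natAbs_pos.mpr hD.ne
  have hq0 : 4 * D.natAbs ≠ 0 := by omega
  -- the union of the classes `r mod q`, `r ∈ A`, has density `#A/φ(q) = 1/2`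
  have hT : HasPrimeDensity
      (⋃ r ∈ ({r ∈ range (4 * D.natAbs) | r.Coprime (4 * D.natAbs) ∧ J(D | r) = -1} : Finset ℕ),
        {p : ℕ | p ≡ r [MOD 4 * D.natAbs]})
      (∑ r ∈ ({r ∈ range (4 * D.natAbs) | r.Coprime (4 * D.natAbs) ∧ J(D | r) = -1} : Finset ℕ),
        (((4 * D.natAbs).totient : ℝ)⁻¹)) := by
    refine hasPrimeDensity_biUnion _ (fun r hr => hasPrimeDensity_setOf_modEq hq0 ?_) ?_
    · exact (mem_filter.1 hr).2.1
    · intro r₁ hr₁ r₂ hr₂ hne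
      simp only [coe_filter, Set.mem_setOf_eq, mem_range] at hr₁ hr₂
      rw [Function.onFun, Set.disjoint_left]
      intro p hp₁ hp₂
      simp only [Set.mem_setOf_eq] at hp₁ hp₂
      have h := hp₁.symm.trans hp₂
      rw [Nat.ModEq, Nat.mod_eq_of_lt hr₁.1, Nat.mod_eq_of_lt hr₂.1] at h
      exact hne h
  have hsum : ∑ r ∈ ({r ∈ range (4 * D.natAbs) | r.Coprime (4 * D.natAbs) ∧ J(D | r) = -1} :
      Finset ℕ), (((4 * D.natAbs).totient : ℝ)⁻¹) = 1 / 2 := by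
    have h2 := two_mul_card_filter_jacobiSym_eq_neg_one hD
    have hφ : ((4 * D.natAbs).totient : ℝ) ≠ 0 := by
      exact_mod_cast (Nat.totient_pos.mpr (Nat.pos_of_ne_zero hq0)).ne'
    have h2' : (2 : ℝ) * #({r ∈ range (4 * D.natAbs) | r.Coprime (4 * D.natAbs) ∧ J(D | r) = -1} :
        Finset ℕ) = (4 * D.natAbs).totient := by
      exact_mod_cast h2
    rw [sum_const, nsmul_eq_mul]
    field_simp
    linarith
  rw [hsum] at hT
  -- the two sets agree at every prime `p > 4|D|`
  refine hT.congr_of_eventually (4 * D.natAbs + 1) fun p hp hprime => ?_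
  have hpq : ¬ p ∣ 4 * D.natAbs := fun h => by
    have := Nat.le_of_dvd (Nat.pos_of_ne_zero hq0) h
    omega
  have hcop : p.Coprime (4 * D.natAbs) := (Nat.Prime.coprime_iff_not_dvd hprime).2 hpq
  have hp2 : p ≠ 2 := by
    rintro rfl
    exact hpq (Dvd.dvd.mul_right (by norm_num) _)
  have hpodd : Odd p := hprime.odd_of_ne_two hp2
  have hmodcop : (p % (4 * D.natAbs)).Coprime (4 * D.natAbs) := by
    rw [Nat.Coprime, ← Nat.gcd_rec, Nat.gcd_comm]
    exact hcop
  have hJ : J(D | p) = J(D | p % (4 * D.natAbs)) := jacobiSym.mod_right D hpodd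
  simp only [Set.mem_iUnion, Set.mem_setOf_eq, exists_prop]
  constructor
  · rintro ⟨r, hr, hpr⟩
    rw [mem_filter, mem_range] at hr
    rw [hJ]
    have : p % (4 * D.natAbs) = r := by
      rw [Nat.ModEq, Nat.mod_eq_of_lt hr.1] at hpr; exact hpr
    rw [this]
    exact hr.2.2
  · intro hJp
    refine ⟨p % (4 * D.natAbs), ?_, (Nat.mod_modEq p (4 * D.natAbs)).symm⟩
    rw [mem_filter, mem_range]
    exact ⟨Nat.mod_lt _ (Nat.pos_of_ne_zero hq0), hmodcop, hJ ▸ hJp⟩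

end WeierstrassCurve
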